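import Summits.Ventures.HodgeRepro2.T5SU11ResolventIdentityDecay

/-!
# Summary XI — the exponentially decaying class is stable under the improper Green's operator, and the
resolvent identity holds on it (rows 499–500), under uniform names

The headline statements of rows 499–500 about `G^I_λ g = −χ_λ ∫_{(0,t]} φ_λ g sinh 2s − φ_λ ∫_{(t,∞)} χ_λ g sinh 2s`
(`greenSolI`, row 492) on the exponentially decaying class of sources (continuous on `(0, ∞)`, bounded on `(0, 1]`,
`|g(s)| ≤ C e^{−εs}` for `s ≥ s₀`, `ε > 2 − λ`), re-exported:

* `greenI_continuousOn`, `greenI_bounded_one` — `G^I_λ g` is continuous on `(0, ∞)` and bounded on `(0, 1]` (row 499);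
* `greenI_tail_decay`, `greenI_head_growth` — the two halves `A^I = ∫_{(t,∞)} χ_λ g sinh` and
  `B^I = ∫_{(0,t]} φ_λ g sinh` satisfy `|A^I(t)| ≤ K e^{−(λ+ε−2)t}` and `|B^I(t)| ≤ K (1 + t) e^{max(λ−ε,0) t}`
  (row 499);
* `greenI_decay_rate`, **`greenI_stable`** — `|G^I_λ g(t)| ≤ K (1 + t) e^{−min(ε,λ) t}` and hence
  **`G^I_λ g` decays at every rate `ε′ < min(ε, λ)`: the class is stable under `G^I_λ`** (row 499);
* `greenI_div_sph_decay` — `G^I_{λ₂} g / φ_λ → 0` for a source of the class at both `λ` and `λ₂` (row 500);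
* `greenI_sub_ode` — `(L − μ)(G^I_λ g − G^I_{λ₂} g) = (μ − μ₂) G^I_{λ₂} g` on `(0, ∞)` (row 500);
* **`resolvent_identity_decay`** — **`G^I_λ g − G^I_{λ₂} g = (μ − μ₂) · G^I_λ(G^I_{λ₂} g)` on `(0, ∞)`: the resolvent
  identity of the radial Laplacian on the whole exponentially decaying class** (row 500).

Nothing is claimed about (N).

Blind lane: Mathlib + the HodgeRepro2 prefix only; no sorry; axioms ⊆ {propext, Classical.choice,
Quot.sound}.
-/

namespace Summit.Ventures.HodgeRepro2.T5SU11RadialSummaryXI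

open Filter Topology MeasureTheory
open Set (Ioi Ioc)
open T5SU11Cartan T5SU11SphericalFunction T5SU11SphericalDecay T5SU11RadialGreenImproper
  T5SU11RadialGreenImproperStable T5SU11ResolventIdentityDecay

section measure

variable [MeasurableSpace Circle] [BorelSpace Circle]

variable {lam : ℝ} (hlam : 1 < lam) {g : ℝ → ℝ} (hg : ContinuousOn g (Ioi 0))
  {M : ℝ} (hM : ∀ s ∈ Ioc (0 : ℝ) 1, |g s| ≤ M) (hM0 : 0 ≤ M)
  {ε C s₀ : ℝ} (hε : 2 - lam < ε) (hC : ∀ s, s₀ ≤ s → |g s| ≤ C * Real.exp (-ε * s))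

include hlam hg hM hM0 hε hC in
/-- **`G^I_λ g` is continuous on `(0, ∞)`** for a source of the exponentially decaying class (row 499). -/
theorem greenI_continuousOn :
    ContinuousOn (greenSolI (fun t => sph lam (hyp t)) (sphDecay lam) g) (Ioi 0) :=
  continuousOn_greenSolI hlam hg hM hM0 hε hC

include hlam hg hM hM0 hε hC in
/-- **`G^I_λ g` is bounded on `(0, 1]`** for a source of the exponentially decaying class (row 499). -/
theorem greenI_bounded_one :
    ∃ M' : ℝ, 0 ≤ M' ∧ ∀ s ∈ Ioc (0 : ℝ) 1, |greenSolI (fun t => sph lam (hyp t)) (sphDecay lam) g s| ≤ M' :=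
  exists_abs_greenSolI_le_of_le_one hlam hg hM hM0 hε hC

include hlam hg hM hM0 hε hC in
/-- **The tail `A^I(t) = ∫_{(t,∞)} χ_λ g sinh 2s` decays like `e^{−(λ+ε−2)t}`** (row 499). -/
theorem greenI_tail_decay :
    ∃ K T : ℝ, 0 ≤ K ∧ ∀ t, T ≤ t → |greenAI (sphDecay lam) g t| ≤ K * Real.exp (-(lam + ε - 2) * t) :=
  abs_greenAI_le_exp hlam hg hM hM0 hε hC

include hlam hg hM hM0 hC in
/-- **The head `B^I(t) = ∫_{(0,t]} φ_λ g sinh 2s` grows at most like `(1 + t) e^{max(λ−ε,0) t}`** (row 499). -/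
theorem greenI_head_growth :
    ∃ K T : ℝ, 0 ≤ K ∧ 0 < T ∧ ∀ t, T ≤ t →
      |greenBI (fun t => sph lam (hyp t)) g t| ≤ K * (1 + t) * Real.exp (max (lam - ε) 0 * t) :=
  abs_greenBI_le_atTop hlam hg hM hM0 hC

include hlam hg hM hM0 hε hC in
/-- **`|G^I_λ g(t)| ≤ K (1 + t) e^{−min(ε, λ) t}`** for `t ≥ T` (row 499). -/
theorem greenI_decay_rate :
    ∃ K T : ℝ, 0 ≤ K ∧ 0 < T ∧ ∀ t, T ≤ t →
      |greenSolI (fun t => sph lam (hyp t)) (sphDecay lam) g t| ≤ K * (1 + t) * Real.exp (-(min ε lam) * t) :=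
  abs_greenSolI_le_atTop hlam hg hM hM0 hε hC

include hlam hg hM hM0 hε hC in
/-- **THE CLASS IS STABLE**: `G^I_λ g` decays exponentially at every rate `ε′ < min(ε, λ)` (row 499). -/
theorem greenI_stable {ε' : ℝ} (hε' : ε' < min ε lam) :
    ∃ K T : ℝ, 0 ≤ K ∧ 0 < T ∧ ∀ t, T ≤ t →
      |greenSolI (fun t => sph lam (hyp t)) (sphDecay lam) g t| ≤ K * Real.exp (-ε' * t) :=
  exists_abs_greenSolI_le_exp hlam hg hM hM0 hε hC hε'

variable {lam₂ : ℝ} (hlam₂ : 1 < lam₂) (hε₂ : 2 - lam₂ < ε)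

include hlam hlam₂ hg hM hM0 hε hε₂ hC in
/-- **`G^I_{λ₂} g / φ_λ → 0`** for a source of the class at both parameters (row 500). -/
theorem greenI_div_sph_decay :
    Tendsto (fun t => greenSolI (fun t => sph lam₂ (hyp t)) (sphDecay lam₂) g t / sph lam (hyp t)) atTop (𝓝 0) :=
  tendsto_greenSolI_div_sph_atTop hlam hlam₂ hg hM hM0 hε hε₂ hC

include hlam hlam₂ in
/-- **`(L − μ)(G^I_λ g − G^I_{λ₂} g) = (μ − μ₂) G^I_{λ₂} g`** on `(0, ∞)` (row 500). -/
theorem greenI_sub_ode {t : ℝ} (ht : 0 < t) :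
    Real.sinh (2 * t) * (greenSolI'' (deriv (deriv fun t => sph lam (hyp t))) (sphDecay'' lam)
          (deriv fun t => sph lam (hyp t)) (sphDecay' lam) (fun t => sph lam (hyp t)) (sphDecay lam) g t
        - greenSolI'' (deriv (deriv fun t => sph lam₂ (hyp t))) (sphDecay'' lam₂)
          (deriv fun t => sph lam₂ (hyp t)) (sphDecay' lam₂) (fun t => sph lam₂ (hyp t)) (sphDecay lam₂) g t)
      + 2 * Real.cosh (2 * t) * (greenSolI' (deriv fun t => sph lam (hyp t)) (sphDecay' lam)
          (fun t => sph lam (hyp t)) (sphDecay lam) g t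
        - greenSolI' (deriv fun t => sph lam₂ (hyp t)) (sphDecay' lam₂) (fun t => sph lam₂ (hyp t))
          (sphDecay lam₂) g t)
      = lam * (lam - 2) * Real.sinh (2 * t) * (greenSolI (fun t => sph lam (hyp t)) (sphDecay lam) g t
          - greenSolI (fun t => sph lam₂ (hyp t)) (sphDecay lam₂) g t)
        + Real.sinh (2 * t) * ((lam * (lam - 2) - lam₂ * (lam₂ - 2))
          * greenSolI (fun t => sph lam₂ (hyp t)) (sphDecay lam₂) g t) :=
  greenSolI_sub_ode hlam hlam₂ (g := g) ht

include hlam hlam₂ hg hM hM0 hε hε₂ hC in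
/-- **THE RESOLVENT IDENTITY ON THE EXPONENTIALLY DECAYING CLASS**:
`G^I_λ g − G^I_{λ₂} g = (μ − μ₂) · G^I_λ(G^I_{λ₂} g)` on `(0, ∞)` (row 500). -/
theorem resolvent_identity_decay {t : ℝ} (ht : 0 < t) :
    greenSolI (fun t => sph lam (hyp t)) (sphDecay lam) g t
        - greenSolI (fun t => sph lam₂ (hyp t)) (sphDecay lam₂) g t
      = (lam * (lam - 2) - lam₂ * (lam₂ - 2))
        * greenSolI (fun t => sph lam (hyp t)) (sphDecay lam)
          (greenSolI (fun t => sph lam₂ (hyp t)) (sphDecay lam₂) g) t :=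
  greenSolI_sub_greenSolI_eq hlam hlam₂ hg hM hM0 hε hε₂ hC ht

end measure

end Summit.Ventures.HodgeRepro2.T5SU11RadialSummaryXI
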